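import Summits.CriticalPhenomena.PercolationContinuityZ3.Theorems.PercNearOneGluingNoHeavyLowerTailSahiBlobReduction
import Summits.CriticalPhenomena.PercolationContinuityZ3.Theorems.PercNearOneGluingNoHeavyLowerTailIncStarCycleEmbedded
import HarnessLib

/-!
# Two-terminal blob reduction, III: graphs built on a marked core

Support file for the Sahi programme (`--supports stmt-CriticalPhenomena-4575`, prover prim-sahi-p2 gen 11).  No definitions,
no named facts, no sorries; standard axioms.  Memo `…/prim-sahi-p2/PROOF-E3.md` §22.

**Setting.**  A *core* is an injection `c : Fin m → V`; every non-core vertex `x` carries a label `β x = s(i,j)` (`i ≠ j`)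
saying that `x` lives in the two-terminal network ("blob") hanging between the core vertices `c i` and `c j`:
`w s(x,z) ≠ 0` forces `z` to be a non-core vertex with the same label, or one of `c i, c j` (hypothesis `hw`).  So the
weighted graph of `w` is the core graph on `range c` (arbitrary weights on core pairs) with an arbitrary finite
two-terminal network substituted in parallel to each core pair.

**Theorems.**
* `exists_coreReduce`: there is a weight `w₀` on the core `Sym2 (Fin m)` such that for every root `c s` and every family
  of principal cluster events with core targets, `E_n` under `bernoulliWeight w` equals `E_n` of the corresponding family
  under `bernoulliWeight w₀` (iterate the blob reduction of Part II over the labels, then pull back along `c`).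
* `sahiE_principal_of_core`: hence if EVERY weight on the core is Sahi-positive for principal families (root `s`), so is
  `w` for principal families rooted at `c s` with core targets; `incStar_of_core`: the same for the increasing star.
Instances with the programme's small-graph theorems (`K₄` at every order, `≤ 5` vertices for the increasing star) are in the
computational companion `…SahiBlobCoreSmall`.
-/

noncomputable section

namespace Summit.CriticalPhenomena.PercolationContinuityZ3.Theorems

namespace SahiBlobReduction

open Finset Set unitInterval MeasureTheory Literature.Probability.Percolation Literature.Probability.LatticeModels
  Literature.Combinatorics.Sahi2008
open Literature.Probability.Percolation.DecisionTree (ind ind_of_mem ind_of_not_mem ind_nonneg)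
open Literature.Probability.Percolation.BlockExploration (exists_openWalk_of_mem_openConnIn)
open scoped Classical

variable {V : Type*}

/-! ### Support inside a vertex set: `{x ↔ y}` versus `{x ↔ y in S}` -/

/-- If no open pair leaves `S`, an open walk from a vertex of `S` stays in `S`. [folklore] -/
theorem support_subset_of_no_exit {ω : BondConfig V} {S : Set V} (hN : ∀ u ∈ S, ∀ v ∉ S, s(u, v) ∉ ω)
    {x y : V} (p : (openGraph ω).Walk x y) (hx : x ∈ S) : ∀ z ∈ p.support, z ∈ S := by
  induction p with
  | nil =>
    intro z hz
    rw [SimpleGraph.Walk.support_nil, List.mem_singleton] at hz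
    exact hz ▸ hx
  | @cons a b _ hab p ih =>
    intro z hz
    have hb : b ∈ S := by
      by_contra hb
      exact hN a hx b hb ((openGraph_adj ω a b).1 hab).1
    rw [SimpleGraph.Walk.support_cons, List.mem_cons] at hz
    rcases hz with rfl | hz
    · exact hx
    · exact ih hb z hz

/-- If no open pair leaves `S ∋ x`, then `{x ↔ y} = {x ↔ y in S}` on this configuration. [folklore] -/
theorem openConn_iff_openConnIn_of_no_exit {ω : BondConfig V} {S : Set V} (hN : ∀ u ∈ S, ∀ v ∉ S, s(u, v) ∉ ω)
    {x y : V} (hx : x ∈ S) : ω ∈ (openConn x y : Set (BondConfig V)) ↔ ω ∈ openConnIn S x y := by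
  constructor
  · rintro ⟨p⟩
    exact mem_openConnIn_of_openWalk p (support_subset_of_no_exit hN p hx)
  · intro h
    obtain ⟨p, -⟩ := exists_openWalk_of_mem_openConnIn h
    exact ⟨p⟩

variable [Fintype V]

/-- Pairs of weight `0` leaving `S` are almost surely all closed. [folklore] -/
theorem ae_no_exit (w : Sym2 V → unitInterval) (S : Set V) (hS : ∀ u ∈ S, ∀ v ∉ S, w s(u, v) = 0) :
    ∀ᵐ ω ∂prodBernoulli w, ∀ u ∈ S, ∀ v ∉ S, s(u, v) ∉ ω := by
  have hZ : ({e : Sym2 V | ∃ u ∈ S, ∃ v ∉ S, e = s(u, v)}).Countable := Set.to_countable _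
  have h := prodBernoulli_ae_forall_notMem w hZ (by
    rintro e ⟨u, hu, v, hv, rfl⟩; exact hS u hu v hv)
  filter_upwards [h] with ω hω u hu v hv using hω _ ⟨u, hu, v, hv, rfl⟩

/-- **Pull-back of principal moments to the core.**  If `w` vanishes on every pair meeting a non-core vertex, the
probability of a principal cluster event with core root and core targets is that of the pulled-back event under
`prodBernoulli (w ∘ Sym2.map c)` on the core. [this work] -/
theorem real_principal_core_pullback {m : ℕ} (w : Sym2 V → unitInterval) {c : Fin m → V}
    (hc : Function.Injective c) (hw : ∀ x, x ∉ Set.range c → ∀ z, w s(x, z) = 0) (s : Fin m)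
    (U : Finset (Fin m)) :
    (prodBernoulli w).real (⋂ t ∈ U, (openConn (c s) (c t) : Set (BondConfig V))) =
      (prodBernoulli (w ∘ Sym2.map c)).real (⋂ t ∈ U, (openConn s t : Set (BondConfig (Fin m)))) := by
  set Ψ : BondConfig V → BondConfig (Fin m) := fun ω => {z : Sym2 (Fin m) | Sym2.map c z ∈ ω} with hΨ
  have hΨm : Measurable Ψ := measurable_set_iff.2 fun z => measurable_set_mem (Sym2.map c z)
  have hS : ∀ u ∈ Set.range c, ∀ v ∉ Set.range c, w s(u, v) = 0 := fun u _ v hv => by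
    rw [Sym2.eq_swap]; exact hw v hv u
  have hae : (⋂ t ∈ U, (openConn (c s) (c t) : Set (BondConfig V))) =ᵐ[prodBernoulli w]
      Ψ ⁻¹' (⋂ t ∈ U, (openConn s t : Set (BondConfig (Fin m)))) := by
    filter_upwards [ae_no_exit w (Set.range c) hS] with ω hω
    rw [eq_iff_iff]
    show ω ∈ (⋂ t ∈ U, (openConn (c s) (c t) : Set (BondConfig V))) ↔
      ω ∈ Ψ ⁻¹' (⋂ t ∈ U, (openConn s t : Set (BondConfig (Fin m))))
    simp only [Set.mem_iInter, Set.mem_preimage]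
    refine forall₂_congr fun t _ => ?_
    rw [openConn_iff_openConnIn_of_no_exit hω ⟨s, rfl⟩]
    exact IncStarCycle.openConnIn_range_iff_pullback hc ω s t
  rw [measureReal_congr hae, measureReal_def, ← Measure.map_apply hΨm MeasurableSet.of_discrete,
    IncStarCycle.prodBernoulli_map_pullback hc]
  rfl

omit [Fintype V] in
/-- Nested intersections of principal events (plumbing). [folklore] -/
private theorem biInter_biInter_eq {ι κ : Type*} [DecidableEq κ] (S : Finset ι) (T : ι → Finset κ)
    (A : κ → Set (BondConfig V)) :
    (⋂ i ∈ S, ⋂ t ∈ T i, A t) = ⋂ t ∈ S.biUnion T, A t := by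
  ext ω
  simp only [Set.mem_iInter, Finset.mem_biUnion]
  constructor
  · rintro h t ⟨i, hi, ht⟩
    exact h i hi t ht
  · intro h i hi t ht
    exact h t ⟨i, hi, ht⟩

/-! ### Iterating the blob reduction over the labels -/

/-- **Core reduction.**  For a core `c` with labelled blobs there is a weight `w₀` on the core such that every Sahi
functional of every principal cluster family with core root and core targets is the same for `w` on `V` and for `w₀` on
the core. [this work] -/
theorem exists_coreReduce {m : ℕ} (w : Sym2 V → unitInterval) {c : Fin m → V} (hc : Function.Injective c)
    (β : V → Sym2 (Fin m)) (hβ : ∀ x, x ∉ Set.range c → ¬ (β x).IsDiag)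
    (hw : ∀ x, x ∉ Set.range c → ∀ z, w s(x, z) ≠ 0 →
      (z ∉ Set.range c ∧ β z = β x) ∨ (∃ i ∈ β x, z = c i)) :
    ∃ w₀ : Sym2 (Fin m) → unitInterval, ∀ (s : Fin m) (n : ℕ) (T : Fin n → Finset (Fin m)),
      sahiE (bernoulliWeight w) n (fun k => ind (⋂ t ∈ T k, (openConn (c s) (c t) : Set (BondConfig V)))) =
        sahiE (bernoulliWeight w₀) n (fun k => ind (⋂ t ∈ T k, (openConn s t : Set (BondConfig (Fin m))))) := by
  -- induction on the set `E` of labels whose blobs may still carry non-zero pairs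
  suffices key : ∀ (E : Finset (Sym2 (Fin m))) (w : Sym2 V → unitInterval),
      (∀ x, x ∉ Set.range c → ∀ z, w s(x, z) ≠ 0 → (z ∉ Set.range c ∧ β z = β x) ∨ (∃ i ∈ β x, z = c i)) →
      (∀ x, x ∉ Set.range c → β x ∉ E → ∀ z, w s(x, z) = 0) →
      ∃ w₀ : Sym2 (Fin m) → unitInterval, ∀ (s : Fin m) (n : ℕ) (T : Fin n → Finset (Fin m)),
        sahiE (bernoulliWeight w) n (fun k => ind (⋂ t ∈ T k, (openConn (c s) (c t) : Set (BondConfig V)))) =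
          sahiE (bernoulliWeight w₀) n (fun k => ind (⋂ t ∈ T k, (openConn s t : Set (BondConfig (Fin m))))) by
    exact key Finset.univ w hw fun x _ hE => absurd (Finset.mem_univ _) hE
  intro E
  induction E using Finset.induction_on with
  | empty =>
    intro w _ hzero
    have hw0 : ∀ x, x ∉ Set.range c → ∀ z, w s(x, z) = 0 := fun x hx z =>
      hzero x hx (Finset.notMem_empty _) z
    refine ⟨w ∘ Sym2.map c, fun s n T => ?_⟩
    refine TwoChainUnions.sahiE_congr_of_prodMoments _ _ n _ _ fun S => ?_
    rw [IncStarCycle.prod_ind_eq_ind_iInter, IncStarCycle.prod_ind_eq_ind_iInter, ex_bernoulliWeight_ind,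
      ex_bernoulliWeight_ind, biInter_biInter_eq, biInter_biInter_eq]
    exact real_principal_core_pullback w hc hw0 s (S.biUnion T)
  | insert e E heE ih =>
    intro w hw hzero
    by_cases hdiag : e.IsDiag
    · -- no blob carries a diagonal label
      refine ih w hw fun x hx hE z => hzero x hx ?_ z
      rw [Finset.mem_insert]
      rintro (h | h)
      · exact hβ x hx (h ▸ hdiag)
      · exact hE h
    obtain ⟨i, j, rfl⟩ : ∃ i j, e = s(i, j) := by
      induction e using Sym2.ind with
      | h i j => exact ⟨i, j, rfl⟩
    have hij : i ≠ j := fun h => hdiag (by rw [Sym2.mk_isDiag_iff]; exact h)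
    -- the blob labelled `s(i, j)`
    set B : Finset V := Finset.univ.filter fun x => x ∉ Set.range c ∧ β x = s(i, j) with hB
    have hmemB : ∀ x, x ∈ B ↔ x ∉ Set.range c ∧ β x = s(i, j) := fun x => by
      rw [hB, Finset.mem_filter]; exact ⟨fun h => h.2, fun h => ⟨Finset.mem_univ _, h⟩⟩
    have hu : c i ∉ B := fun h => ((hmemB _).1 h).1 ⟨i, rfl⟩
    have hv : c j ∉ B := fun h => ((hmemB _).1 h).1 ⟨j, rfl⟩
    have huv : c i ≠ c j := fun h => hij (hc h)
    have hcore : ∀ s : Fin m, c s ∉ B := fun s h => ((hmemB _).1 h).1 ⟨s, rfl⟩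
    have hblob : ∀ x ∈ B, ∀ z, z ∉ B → z ≠ c i → z ≠ c j → w s(x, z) = 0 := by
      intro x hx z hzB hzi hzj
      obtain ⟨hxc, hβx⟩ := (hmemB x).1 hx
      by_contra hne
      rcases hw x hxc z hne with ⟨hzc, hβz⟩ | ⟨i', hi', rfl⟩
      · exact hzB ((hmemB z).2 ⟨hzc, hβz.trans hβx⟩)
      · rw [hβx] at hi'
        rcases Sym2.mem_iff.1 hi' with rfl | rfl
        · exact hzi rfl
        · exact hzj rfl
    obtain ⟨w', hw'B, hw'off, -, hw'E⟩ := exists_blobReduce w B hu hv huv hblob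
    -- `w'` off the blob pairs
    have hw'eq : ∀ x z : V, x ∉ Set.range c → x ∉ B → z ∉ B → w' s(x, z) = w s(x, z) := by
      intro x z hxc hxB hzB
      refine hw'off _ (fun x' hx' hmem => ?_) (fun h => ?_)
      · rcases Sym2.mem_iff.1 hmem with rfl | rfl
        · exact hxB hx'
        · exact hzB hx'
      · rcases Sym2.eq_iff.1 h with ⟨h1, _⟩ | ⟨h1, _⟩
        · exact hxc ⟨i, h1.symm⟩
        · exact hxc ⟨j, h1.symm⟩
    have hw'zero_of_mem : ∀ x z : V, z ∈ B → w' s(x, z) = 0 := fun x z hz => by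
      rw [Sym2.eq_swap]; exact hw'B z hz x
    -- the structural hypothesis survives
    have hw' : ∀ x, x ∉ Set.range c → ∀ z, w' s(x, z) ≠ 0 →
        (z ∉ Set.range c ∧ β z = β x) ∨ (∃ i ∈ β x, z = c i) := by
      intro x hxc z hne
      by_cases hxB : x ∈ B
      · exact absurd (hw'B x hxB z) hne
      by_cases hzB : z ∈ B
      · exact absurd (hw'zero_of_mem x z hzB) hne
      rw [hw'eq x z hxc hxB hzB] at hne
      exact hw x hxc z hne
    -- every label outside `E` is now dead
    have hzero' : ∀ x, x ∉ Set.range c → β x ∉ E → ∀ z, w' s(x, z) = 0 := by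
      intro x hxc hE z
      by_cases hxB : x ∈ B
      · exact hw'B x hxB z
      by_cases hzB : z ∈ B
      · exact hw'zero_of_mem x z hzB
      rw [hw'eq x z hxc hxB hzB]
      refine hzero x hxc (fun h => ?_) z
      rcases Finset.mem_insert.1 h with h | h
      · exact hxB ((hmemB x).2 ⟨hxc, h⟩)
      · exact hE h
    obtain ⟨w₀, hw₀⟩ := ih w' hw' hzero'
    refine ⟨w₀, fun s n T => ?_⟩
    rw [← hw₀ s n T]
    -- the blob reduction, with the targets written as vertex sets of `V`
    have hfam : (fun k => ind (⋂ t ∈ T k, (openConn (c s) (c t) : Set (BondConfig V)))) =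
        fun k => ind (⋂ t ∈ (T k).image c, (openConn (c s) t : Set (BondConfig V))) := by
      funext k
      rw [Finset.set_biInter_finset_image]
    rw [hfam]
    exact hw'E (c s) (hcore s) n (fun k => (T k).image c) fun k t ht => by
      obtain ⟨t', -, rfl⟩ := Finset.mem_image.1 ht
      exact hcore t'

/-- **Principal positivity passes from the core to the core with blobs.**  If every weight on the core `Fin m` makes all
principal cluster families rooted at `s` Sahi-positive at every order, then so does every weight on `V` built on the core
`c` with arbitrary finite two-terminal networks between core pairs, for families rooted at `c s` with core targets.
[this work] -/
theorem sahiE_principal_of_core {m : ℕ} (w : Sym2 V → unitInterval) {c : Fin m → V} (hc : Function.Injective c)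
    (β : V → Sym2 (Fin m)) (hβ : ∀ x, x ∉ Set.range c → ¬ (β x).IsDiag)
    (hw : ∀ x, x ∉ Set.range c → ∀ z, w s(x, z) ≠ 0 →
      (z ∉ Set.range c ∧ β z = β x) ∨ (∃ i ∈ β x, z = c i))
    (s : Fin m)
    (hpos : ∀ (w₀ : Sym2 (Fin m) → unitInterval) (n : ℕ) (T : Fin n → Finset (Fin m)),
      0 ≤ sahiE (bernoulliWeight w₀) n (fun k => ind (⋂ t ∈ T k, (openConn s t : Set (BondConfig (Fin m))))))
    (n : ℕ) (T : Fin n → Finset (Fin m)) :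
    0 ≤ sahiE (bernoulliWeight w) n (fun k => ind (⋂ t ∈ T k, (openConn (c s) (c t) : Set (BondConfig V)))) := by
  obtain ⟨w₀, hw₀⟩ := exists_coreReduce w hc β hβ hw
  rw [hw₀ s n T]
  exact hpos w₀ n T

/-- **The increasing star passes from the core to the core with blobs.**  If the increasing star holds at root `s` for
every weight on the core `Fin m` (same core labels of root and targets), it holds for `w` at root `c s` and the
corresponding core targets. [this work] -/
theorem incStar_of_core {m : ℕ} (w : Sym2 V → unitInterval) {c : Fin m → V} (hc : Function.Injective c)
    (β : V → Sym2 (Fin m)) (hβ : ∀ x, x ∉ Set.range c → ¬ (β x).IsDiag)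
    (hw : ∀ x, x ∉ Set.range c → ∀ z, w s(x, z) ≠ 0 →
      (z ∉ Set.range c ∧ β z = β x) ∨ (∃ i ∈ β x, z = c i))
    (s a b d : Fin m)
    (hstar : ∀ w₀ : Sym2 (Fin m) → unitInterval,
      0 ≤ sahiE3 (prodBernoulli w₀) (openConn s a) (openConn s b) (openConn s d)) :
    0 ≤ sahiE3 (prodBernoulli w) (openConn (c s) (c a)) (openConn (c s) (c b)) (openConn (c s) (c d)) := by
  obtain ⟨w₀, hw₀⟩ := exists_coreReduce w hc β hβ hw
  have h := hw₀ s 3 ![{a}, {b}, {d}]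
  have hf : (fun k : Fin 3 => ind (⋂ t ∈ (![{a}, {b}, {d}] : Fin 3 → Finset (Fin m)) k,
      (openConn (c s) (c t) : Set (BondConfig V)))) =
      ![ind (openConn (c s) (c a)), ind (openConn (c s) (c b)), ind (openConn (c s) (c d))] := by
    funext k; fin_cases k <;> simp
  have hf₀ : (fun k : Fin 3 => ind (⋂ t ∈ (![{a}, {b}, {d}] : Fin 3 → Finset (Fin m)) k,
      (openConn s t : Set (BondConfig (Fin m))))) =
      ![ind (openConn s a), ind (openConn s b), ind (openConn s d)] := by
    funext k; fin_cases k <;> simp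
  rw [hf, hf₀, sahiE_three_ind, sahiE_three_ind] at h
  rw [h]
  exact hstar w₀

/-! ### Appendix: the reduced pair weight is the blob's intrinsic two-terminal probability -/

/-- **The weight carried by the reduced pair is the probability, under `w` itself, that the blob joins its terminals
inside `B ∪ {u, v}`.**  (The statements above phrase it through the restriction of `w` to the blob pairs; this lemma
identifies the two.) [this work] -/
theorem blobRestrict_real_openConn_eq (w : Sym2 V → unitInterval) (B : Finset V) {u v : V} (hu : u ∉ B)
    (hv : v ∉ B) (huv : u ≠ v) (hw : ∀ x ∈ B, ∀ z, z ∉ B → z ≠ u → z ≠ v → w s(x, z) = 0) :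
    (prodBernoulli (fun e' => if (∃ x' ∈ B, x' ∈ e') ∨ e' = s(u, v) then w e' else 0)).real (openConn u v) =
      (prodBernoulli w).real (openConnIn (↑B ∪ {u, v}) u v) := by
  set S : Set V := ↑B ∪ {u, v} with hS
  set wb : Sym2 V → unitInterval := fun e' => if (∃ x' ∈ B, x' ∈ e') ∨ e' = s(u, v) then w e' else 0 with hwb
  have huS : u ∈ S := Or.inr (Set.mem_insert u {v})
  -- (1) under `wb` almost surely no open pair leaves `S`, so `{u ↔ v} = {u ↔ v in S}`
  have hexit : ∀ y ∈ S, ∀ y' ∉ S, wb s(y, y') = 0 := by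
    intro y hy y' hy'
    have hy'B : y' ∉ B := fun h => hy' (Or.inl h)
    have hy'u : y' ≠ u := fun h => hy' (h ▸ Or.inr (Set.mem_insert u {v}))
    have hy'v : y' ≠ v := fun h => hy' (h ▸ Or.inr (Set.mem_insert_of_mem u rfl))
    simp only [hwb]
    split_ifs with hcase
    · rcases hcase with ⟨x', hx'B, hx'⟩ | heq
      · rcases Sym2.mem_iff.1 hx' with rfl | rfl
        · exact hw _ hx'B y' hy'B hy'u hy'v
        · exact absurd hx'B hy'B
      · exfalso
        rcases Sym2.eq_iff.1 heq with ⟨_, h2⟩ | ⟨_, h2⟩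
        · exact hy'v h2
        · exact hy'u h2
    · rfl
  have h1 : (prodBernoulli wb).real (openConn u v) = (prodBernoulli wb).real (openConnIn S u v) := by
    refine measureReal_congr ?_
    filter_upwards [ae_no_exit wb S hexit] with ω hω
    rw [eq_iff_iff]
    exact openConn_iff_openConnIn_of_no_exit hω huS
  -- (2) `{u ↔ v in S}` is determined by the off-diagonal pairs inside `S`, where `wb = w`
  have h2 : (prodBernoulli wb).real (openConnIn S u v) = (prodBernoulli w).real (openConnIn S u v) := by
    refine prodBernoulli_real_eq_of_determinedBy _ _ (fun z hz => ?_)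
      (IncStarCutVertex.determinedBy_openConnIn_offDiag S u v) MeasurableSet.of_discrete
    obtain ⟨hzd, hzS⟩ := hz
    simp only [hwb]
    rw [if_pos]
    revert hzd hzS
    induction z using Sym2.ind with
    | h a b =>
      intro hzd hzS
      have ha : a ∈ S := hzS a (Sym2.mem_mk_left a b)
      have hb : b ∈ S := hzS b (Sym2.mem_mk_right a b)
      have hab : a ≠ b := fun h => hzd (by rw [Sym2.mk_isDiag_iff]; exact h)
      rcases ha with haB | hau
      · exact Or.inl ⟨a, haB, Sym2.mem_mk_left a b⟩
      rcases hb with hbB | hbv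
      · exact Or.inl ⟨b, hbB, Sym2.mem_mk_right a b⟩
      right
      rcases Set.mem_insert_iff.1 hau with rfl | hau'
      · rcases Set.mem_insert_iff.1 hbv with h | h
        · exact absurd h.symm hab
        · rw [Set.mem_singleton_iff.1 h]
      · have hav : a = v := Set.mem_singleton_iff.1 hau'
        subst hav
        rcases Set.mem_insert_iff.1 hbv with h | h
        · rw [h]; exact Sym2.eq_swap
        · exact absurd (Set.mem_singleton_iff.1 h).symm hab
  rw [h1, h2]

/-- **Blob reduction with the intrinsic pair weight**: as `sahiE_principal_blobReduce`, with `w' s(u,v)` equal to the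
probability under `w` that `u` and `v` are joined inside `B ∪ {u,v}`. [this work] -/
theorem sahiE_principal_blobReduce_openConnIn (w w' : Sym2 V → unitInterval) (B : Finset V) {u v s : V}
    (hu : u ∉ B) (hv : v ∉ B) (huv : u ≠ v) (hs : s ∉ B)
    (hw : ∀ x ∈ B, ∀ z, z ∉ B → z ≠ u → z ≠ v → w s(x, z) = 0)
    (hw'B : ∀ x ∈ B, ∀ z, w' s(x, z) = 0)
    (hw'off : ∀ e, (∀ x ∈ B, x ∉ e) → e ≠ s(u, v) → w' e = w e)
    (hw'uv : (w' s(u, v) : ℝ) = (prodBernoulli w).real (openConnIn (↑B ∪ {u, v}) u v))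
    (n : ℕ) (T : Fin n → Finset V) (hT : ∀ i, ∀ t ∈ T i, t ∉ B) :
    sahiE (bernoulliWeight w) n (fun i => ind (⋂ t ∈ T i, (openConn s t : Set (BondConfig V)))) =
      sahiE (bernoulliWeight w') n (fun i => ind (⋂ t ∈ T i, (openConn s t : Set (BondConfig V)))) :=
  sahiE_principal_blobReduce w w' B hu hv huv hs hw hw'B hw'off
    (hw'uv.trans (blobRestrict_real_openConn_eq w B hu hv huv hw).symm) n T hT

end SahiBlobReduction

end Summit.CriticalPhenomena.PercolationContinuityZ3.Theorems
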